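import Summits.HodgeConjecture.CorCM.MumfordTateRankCMCurvesTowerRigid
import Summits.HodgeConjecture.CorCM.MumfordTateRankProductsOfCurves
import HarnessLib

/-!
# A simple type-IV(2,1) threefold times ANY pairwise non-isogenous elliptic curves: `t(T × ⨁E) + 1 + δ = t(T) + t(⨁E)`, `δ = 1` iff some CM
# curve has its field inside `End⁰T`; i.e. `t = 10 + 3a + b − δ` (Moonen–Zarhin 1999 §3 (3.1), (3.4), (3.6), (3.8), Thm. 0.1 (4))

COR-CM (cell `pub-hodgecm2`, seat `b27` gen 51, count-neutral Mumford–Tate-rank ladder; theorems only, no definition, no named fact;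
UNCONDITIONAL — nothing here uses or asserts HC_CM).  Notation `t(X) = dim MT(H¹X)`; `k = End⁰T` imaginary quadratic, `t(T) = 10`; `a` (`b`) the
number of non-CM (CM) curves.

`CorCM/MumfordTateRankThreefoldTimesCurves` (gen 49) computed `t(T × E₀ × ⋯ × E_m)` for simple threefolds with TOTALLY REAL `End⁰T` and left the
type-IV row open («the simple threefolds with `dim_ℚ End⁰T ∈ {2, 6}` times CM curves depend on field embeddings»); gen 50 did two curves
(`CorCM/MumfordTateRankTypeIVThreefoldTimesCurves`, `t ∈ {10, …, 16}`).  With the tower theorem (`CorCM/MumfordTateRankTypeIVTimesCMCurvesTower`) and the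
same-field stacking cell (`CorCM/MumfordTateRankCMCurvesTowerRigid` §4) the row closes for any number of pairwise non-isogenous curves:
* §1 **`mtRank_hodge_one_eq_of_isIsogenous_typeIV_threefold_prod_biproduct_cmCurves_of_nonempty`** — CM curves `E₀, …, E_m`, one of them with
  `End⁰E_{j₀} ↪ k`: `t(T × ⨁E) = m + 10` (the others have `End⁰E_j ↛ k`, else they would be isogenous to `E_{j₀}`; split `E_{j₀}` off and reindex).
* §2 THE RELATIVE FORM for ARBITRARY pairwise non-isogenous curves (CM of any field, or not CM):
  **`mtRank_hodge_one_add_one_eq_of_isIsogenous_typeIV_threefold_prod_biproduct_curves_of_isEmpty`** — no CM curve has its field in `k`: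
  `t(T × ⨁E) + 1 = t(T) + t(⨁E)` (`Hg(T × ⨁E) = Hg(T) × Hg(⨁E)`);
  **`mtRank_hodge_one_add_two_eq_of_isIsogenous_typeIV_threefold_prod_biproduct_curves_of_nonempty`** — some CM curve has `End⁰E_{j₀} ↪ k`:
  `t(T × ⨁E) + 2 = t(T) + t(⨁E)` (that curve's `U(1)` is absorbed in `U(2,1)`).
  Proof: split the index set by «CM» (`isIsogenous_biproduct_prod_subtype`, reindex by `Fin`), `X ∼ (T × ⨁E_CM) × ⨁E_N`; the non-CM curves add `3`
  each to both sides (`Hom(T × ⨁E_CM, E_N,j) = 0`, Lemma (3.4) with repetitions excluded: `CorCM/MumfordTateRankTimesNonCMCurve`), the CM curves give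
  `t(T × ⨁E_CM) = 10 + b − δ` (tower / §1) against `t(⨁E_CM) = b + 1` (Kubota), and `t(⨁E) = 3a + b + 1`.
* §3 the cells: **`t(T × E₀ × ⋯ × E_m) = 3a + b + 10 − δ`** with `a + b` the number of curves (`exists_mtRank_hodge_one_eq_…`).

## References
* [MoonenZarhin1999LowDim] B. Moonen, Yu. G. Zarhin, *Hodge classes on abelian varieties of low dimension*, Math. Ann. 315 (1999), §2 (2.3), §3 (3.1),
  Lemma (3.4), (3.6), Prop. (3.8), Thm. 0.1 (4) [corpus: paper:arxiv-math_9901113 pp. 1, 5–7]. [cite: MoonenZarhin1999LowDim, §3 (3.4), (3.6) and (3.8)]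
* [Gordon1999HodgeAVSurvey] B. B. Gordon, *A survey of the Hodge conjecture for abelian varieties*, §3 Theorem (Imai), 7.5, 7.6.1.
  [cite: Gordon1999HodgeAVSurvey, §3 Theorem (Imai) and 7.6.1]
* [MumfordAV1970] D. Mumford, *Abelian Varieties* (1970), §19 Thm. 1, Cor. 2. [cite: MumfordAV1970, §19 Cor. 2 of Thm. 1]
-/

noncomputable section

open CategoryTheory CategoryTheory.Limits Module
open scoped BigOperators

namespace Summit.HodgeConjecture.CorCM

open Literature.AlgebraicGeometry.Motives
open Literature.AlgebraicGeometry.Motives.AbelianVariety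
open Literature.AlgebraicGeometry.Motives.HodgeStructure
open Literature.AlgebraicGeometry.HodgeTheory
open Literature.AlgebraicGeometry.ComplexMultiplication
open Literature.AlgebraicGeometry.Milne1999 (IsOfCMType hom_eq_zero_of_isSimple_of_not_isIsogenous)

variable [HodgeTensorFacts.{0, 0}] {X X' T : AbelianVariety ℂ} {n n' : ℕ} {m : ℕ} {E : Fin (m + 1) → AbelianVariety ℂ}

/-! ## §0 Plumbing: maps out of `T × Y`, sub-families -/

omit [HodgeTensorFacts.{0, 0}] in
/-- **`Hom(T × Y, C) = 0` from `Hom(T, C) = 0` and `Hom(Y, C) = 0`** (`𝟙 = fst ≫ (𝟙, 0) + snd ≫ (0, 𝟙)`). [cite: MumfordAV1970, §19 Thm. 1] -/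
theorem hom_prod_eq_zero_of_forall_eq_zero {Y C : AbelianVariety ℂ} (hT : ∀ u : T ⟶ C, u = 0) (hY : ∀ u : Y ⟶ C, u = 0)
    (u : T.prod Y ⟶ C) : u = 0 := by
  have hsum : fst T Y ≫ prodLift (𝟙 T) (0 : T ⟶ Y) + snd T Y ≫ prodLift (0 : Y ⟶ T) (𝟙 Y) = 𝟙 _ := by
    refine prod_hom_ext ?_ ?_
    · rw [Preadditive.add_comp, Category.assoc, Category.assoc, prodLift_fst, prodLift_fst, Category.comp_id,
        comp_zero, add_zero, Category.id_comp]
    · rw [Preadditive.add_comp, Category.assoc, Category.assoc, prodLift_snd, prodLift_snd, Category.comp_id,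
        comp_zero, zero_add, Category.id_comp]
  rw [← Category.id_comp u, ← hsum, Preadditive.add_comp, Category.assoc, Category.assoc, hT (prodLift _ _ ≫ u), hY (prodLift _ _ ≫ u),
    comp_zero, comp_zero, add_zero]

omit [HodgeTensorFacts.{0, 0}] in
/-- **Splitting a family of pairwise non-isogenous elliptic curves with both CM and non-CM members by «CM»**: `⨁E ∼ (⨁E_C) × (⨁E_N)` with
`E_C : Fin (m_C + 1) → AV` the CM curves and `E_N : Fin (m_N + 1) → AV` the others, re-indexed, `(m_C + 1) + (m_N + 1) = m + 1`; each `E_C i`,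
`E_N i` is one of the `E_j`, and every CM `E_j` is an `E_C i`. [cite: MumfordAV1970, §19 Thm. 1] -/
theorem exists_split_cm_nonCM_curves (hE1 : ∀ j, (E j).dim = 1) (hniso : ∀ i j, i ≠ j → ¬ IsIsogenous (E i) (E j))
    {j₁ j₂ : Fin (m + 1)} (hj₁ : ¬ IsOfCMType (E j₁)) (hj₂ : IsOfCMType (E j₂)) :
    ∃ (mC mN : ℕ) (EC : Fin (mC + 1) → AbelianVariety ℂ) (EN : Fin (mN + 1) → AbelianVariety ℂ),
      (mC + 1) + (mN + 1) = m + 1 ∧ (∀ i, ∃ j, EC i = E j) ∧ (∀ i, ∃ j, EN i = E j) ∧ (∀ j, IsOfCMType (E j) → ∃ i, EC i = E j) ∧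
      (∀ i, (EC i).dim = 1) ∧ (∀ i, (EN i).dim = 1) ∧ (∀ i, IsOfCMType (EC i)) ∧ (∀ i, ¬ IsOfCMType (EN i)) ∧
      (∀ i i', i ≠ i' → ¬ IsIsogenous (EC i) (EC i')) ∧ (∀ i i', i ≠ i' → ¬ IsIsogenous (EN i) (EN i')) ∧
      (∀ i i', ¬ IsIsogenous (EC i) (EN i')) ∧ IsIsogenous (⨁ E) ((⨁ EC).prod (⨁ EN)) := by
  classical
  let p : Fin (m + 1) → Prop := fun j => IsOfCMType (E j)
  have hsplit := isIsogenous_biproduct_prod_subtype E p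
  have hcC : Fintype.card {j // p j} ≠ 0 := (Fintype.card_pos_iff.2 ⟨⟨j₂, hj₂⟩⟩).ne'
  have hcN : Fintype.card {j // ¬ p j} ≠ 0 := (Fintype.card_pos_iff.2 ⟨⟨j₁, hj₁⟩⟩).ne'
  obtain ⟨mC, hmC⟩ := Nat.exists_eq_succ_of_ne_zero hcC
  obtain ⟨mN, hmN⟩ := Nat.exists_eq_succ_of_ne_zero hcN
  let eC : Fin (mC + 1) ≃ {j // p j} := (finCongr hmC).symm.trans (Fintype.equivFin {j // p j}).symm
  let eN : Fin (mN + 1) ≃ {j // ¬ p j} := (finCongr hmN).symm.trans (Fintype.equivFin {j // ¬ p j}).symm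
  let EC : Fin (mC + 1) → AbelianVariety ℂ := (fun j : {j // p j} => E j.1) ∘ eC
  let EN : Fin (mN + 1) → AbelianVariety ℂ := (fun j : {j // ¬ p j} => E j.1) ∘ eN
  have hPC : IsIsogenous (⨁ fun j : {j // p j} => E j.1) (⨁ EC) :=
    ⟨(biproduct.reindex eC (fun j : {j // p j} => E j.1)).inv, isIsogeny_hom_of_iso (biproduct.reindex eC _).symm⟩
  have hPN : IsIsogenous (⨁ fun j : {j // ¬ p j} => E j.1) (⨁ EN) :=
    ⟨(biproduct.reindex eN (fun j : {j // ¬ p j} => E j.1)).inv, isIsogeny_hom_of_iso (biproduct.reindex eN _).symm⟩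
  have hcard : Fintype.card {j // ¬ p j} = Fintype.card (Fin (m + 1)) - Fintype.card {j // p j} := Fintype.card_subtype_compl p
  have hle : Fintype.card {j // p j} ≤ Fintype.card (Fin (m + 1)) := Fintype.card_subtype_le p
  rw [Fintype.card_fin] at hcard hle
  refine ⟨mC, mN, EC, EN, by omega, fun i => ⟨(eC i).1, rfl⟩, fun i => ⟨(eN i).1, rfl⟩, fun j hj => ⟨eC.symm ⟨j, hj⟩, by simp [EC]⟩,
    fun i => hE1 _, fun i => hE1 _, fun i => (eC i).2, fun i => (eN i).2, fun i i' hii' => hniso _ _ fun h => hii' ?_,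
    fun i i' hii' => hniso _ _ fun h => hii' ?_, fun i i' => hniso _ _ fun h => (eN i').2 (h ▸ (eC i).2), hsplit.trans (hPC.prod hPN)⟩
  · exact eC.injective (Subtype.ext h)
  · exact eN.injective (Subtype.ext h)

/-! ## §1 CM curves, one of them with its field inside `k = End⁰T`: `t(T × ⨁E) = m + 10` -/

/-- **`t(T × E₀ × ⋯ × E_m) = m + 10`** for a simple abelian threefold `T` with `dim_ℚ End⁰T = 2`, pairwise non-isogenous CM elliptic curves
`E₀, …, E_m`, and SOME `E_{j₀}` with `End⁰E_{j₀} ↪ End⁰T`: then `End⁰E_j ↛ End⁰T` for `j ≠ j₀` (two CM fields inside the quadratic `End⁰T`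
coincide, and CM curves with a ring homomorphism between their fields are isogenous), so `X ∼ (T × ⨁_{j ≠ j₀} E_j) × E_{j₀}` is the
same-field stacking cell of `CorCM/MumfordTateRankCMCurvesTowerRigid`: `(m − 1) + 11`; for `m = 0`, `t(E₀ × T) = 10`.
[cite: MoonenZarhin1999LowDim, Thm. 0.1 (4), §3 (3.1), (3.6) and (3.8)] -/
theorem mtRank_hodge_one_eq_of_isIsogenous_typeIV_threefold_prod_biproduct_cmCurves_of_nonempty (hX : IsSmoothProjective n X.X)
    (hTs : T.IsSimple) (hT3 : T.dim = 3) (hTE : Module.finrank ℚ T.endAlgebra = 2)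
    (hE1 : ∀ j, (E j).dim = 1) (hEcm : ∀ j, IsOfCMType (E j)) (hniso : ∀ i j, i ≠ j → ¬ IsIsogenous (E i) (E j))
    {j₀ : Fin (m + 1)} (hj₀ : Nonempty ((E j₀).endAlgebra →+* T.endAlgebra)) (hXP : IsIsogenous X (T.prod (⨁ E))) :
    haveI := BettiUniverse.finite hX 1
    (BettiUniverse.hodge exists_isReal_hodgeModel_holds hX 1).mtRank = m + 10 := by
  classical
  haveI := BettiUniverse.finite hX 1
  -- the other curves have fields not mapping to `k`
  have hfor : ∀ j, j ≠ j₀ → IsEmpty ((E j).endAlgebra →+* T.endAlgebra) := by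
    intro j hj
    by_contra hne
    rw [not_isEmpty_iff] at hne
    exact hniso j₀ j (Ne.symm hj) (isIsogenous_of_nonempty_ringHom_of_cmCurves (hE1 j₀) (hEcm j₀) (hE1 j) (hEcm j)
      (nonempty_ringHom_of_cmCurves_of_nonempty (hE1 j₀) (hEcm j₀) hTE hj₀ hne))
  cases m with
  | zero =>
    -- one curve: `X ∼ E₀ × T`
    have hET : IsSmoothProjective ((E j₀).prod T).dim ((E j₀).prod T).X := AbelianVariety.isSmoothProjective_holds
    haveI := BettiUniverse.finite hET 1
    have hB : IsIsogenous (⨁ E) (E j₀) := isIsogenous_biproduct_of_forall_eq E j₀ fun j => Fin.ext (by have := j.2; have := j₀.2; omega)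
    have hXQ : IsIsogenous X ((E j₀).prod T) := (hXP.trans ((IsIsogenous.refl T).prod hB)).trans (isIsogenous_prod_comm T (E j₀))
    have h10 := mtRank_hodge_one_eq_ten_of_isIsogenous_cmCurve_prod_isSimple_threefold_of_nonempty_ringHom hX (hE1 j₀) (hEcm j₀) hTs hT3 hTE
      hj₀ hXQ
    omega
  | succ m' =>
    -- split `E_{j₀}` off and reindex the rest by `Fin (m' + 1)`
    let e : Fin (m' + 1) ≃ {j // j ≠ j₀} := finSuccAboveEquiv j₀
    let E' : Fin (m' + 1) → AbelianVariety ℂ := (fun j : {j // j ≠ j₀} => E j.1) ∘ e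
    have hsub : IsIsogenous (⨁ fun j : {j // j ≠ j₀} => E j.1) (⨁ E') :=
      ⟨(biproduct.reindex e (fun j : {j // j ≠ j₀} => E j.1)).inv, isIsogeny_hom_of_iso (biproduct.reindex e _).symm⟩
    have hXQ : IsIsogenous X ((T.prod (⨁ E')).prod (E j₀)) :=
      (hXP.trans ((IsIsogenous.refl T).prod ((isIsogenous_biproduct_prod_erase E j₀).trans (hsub.prod (IsIsogenous.refl _))))).trans
        (Literature.AlgebraicGeometry.HodgeTheory.isIsogenous_prod_assoc T (⨁ E') (E j₀)).symm'
    have h := mtRank_hodge_one_eq_of_isIsogenous_threefold_prod_biproduct_cmCurves_prod_sameField hX hTs hT3 hTE (E := E')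
      (fun i => hE1 _) (fun i => hEcm _) (fun i i' hii' => hniso _ _ fun h => hii' (e.injective (Subtype.ext h)))
      (fun i => hfor _ (e i).2) (hE1 j₀) (hEcm j₀) hj₀ hXQ
    omega

/-! ## §2 The relative form for arbitrary pairwise non-isogenous curves -/

/-- **`t(T × ⨁E) + 1 = t(T) + t(⨁E)` — `Hg(T × E₀ × ⋯ × E_m) = Hg(T) × Hg(E₀ × ⋯ × E_m)`** — for a simple abelian threefold `T` with
`dim_ℚ End⁰T = 2` and pairwise non-isogenous elliptic curves `E₀, …, E_m` (CM or not) such that NO CM curve among them has `End⁰E_j ↪ End⁰T`.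
(Split by «CM»: the non-CM curves add `3` each on both sides, Lemma (3.4); the CM ones give `t(T × ⨁E_C) = 10 + #C` by the tower theorem against
`t(⨁E_C) = #C + 1`.) [cite: MoonenZarhin1999LowDim, §3 (3.4), (3.6) and (3.8)] [cite: Gordon1999HodgeAVSurvey, §3 Theorem (Imai) and 7.6.1] -/
theorem mtRank_hodge_one_add_one_eq_of_isIsogenous_typeIV_threefold_prod_biproduct_curves_of_isEmpty (hX : IsSmoothProjective n X.X)
    (hX' : IsSmoothProjective n' X'.X) (hTs : T.IsSimple) (hT3 : T.dim = 3) (hTE : Module.finrank ℚ T.endAlgebra = 2)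
    (hE1 : ∀ j, (E j).dim = 1) (hniso : ∀ i j, i ≠ j → ¬ IsIsogenous (E i) (E j))
    (hfor : ∀ j, IsOfCMType (E j) → IsEmpty ((E j).endAlgebra →+* T.endAlgebra))
    (hXP : IsIsogenous X (T.prod (⨁ E))) (hX'E : IsIsogenous X' (⨁ E)) :
    haveI := BettiUniverse.finite hX 1
    haveI := BettiUniverse.finite hX' 1
    (BettiUniverse.hodge exists_isReal_hodgeModel_holds hX 1).mtRank + 1 =
      10 + (BettiUniverse.hodge exists_isReal_hodgeModel_holds hX' 1).mtRank := by
  classical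
  haveI := BettiUniverse.finite hX 1
  haveI := BettiUniverse.finite hX' 1
  have hT : IsSmoothProjective T.dim T.X := AbelianVariety.isSmoothProjective_holds
  haveI := BettiUniverse.finite hT 1
  have h10 : (BettiUniverse.hodge exists_isReal_hodgeModel_holds hT 1).mtRank = 10 :=
    (mtRank_hodge_one_of_isSimple_threefold_of_finrank_endAlgebra_eq_two hT hTs hT3 hTE).1
  have hTE0 : ∀ {C : AbelianVariety ℂ}, C.dim = 1 → ∀ u : T ⟶ C, u = 0 := fun hC1 u =>
    hom_eq_zero_of_isSimple_of_not_isIsogenous hTs (isSimple_of_dim_le_one hC1.le)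
      (fun h => by have hd : T.dim = _ := dim_eq_of_isIsogenous_holds h; rw [hC1] at hd; omega) u
  by_cases hall : ∀ j, IsOfCMType (E j)
  · -- all CM: tower `m + 11` against Kubota `m + 2`
    have h := mtRank_hodge_one_eq_of_isIsogenous_typeIV_threefold_prod_biproduct_cmCurves hX hTs hT3 hTE hE1 hall hniso
      (fun j => hfor j (hall j)) hXP
    have h' := mtRank_hodge_one_eq_card_add_one_of_isIsogenous_biproduct_elliptic (C := Fin (m + 1)) hE1 hall hniso (cls := id)
      Function.surjective_id hX' hX'E
    rw [Fintype.card_fin] at h'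
    omega
  by_cases hnone : ∀ j, ¬ IsOfCMType (E j)
  · -- no CM curve: `10 + 3(m+1)` against `3(m+1) + 1`
    have h := mtRank_hodge_one_eq_add_of_isIsogenous_prod_biproduct_nonCM_curves hX hT (by omega) hE1 hnone
      (fun j l hjl => hniso j l hjl) (fun j u => hTE0 (hE1 j) u) hXP
    have h' := mtRank_hodge_one_eq_of_biproduct_nonCM_curves hX' hE1 hnone (fun j l hjl => hniso j l hjl) hX'E
    omega
  -- mixed: split by «CM»
  push Not at hall hnone
  obtain ⟨j₁, hj₁⟩ := hall
  obtain ⟨j₂, hj₂⟩ := hnone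
  obtain ⟨mC, mN, EC, EN, hcard, hCE, hNE, -, hEC1, hEN1, hECcm, hENcm, hECniso, hENniso, hCN, hsplit⟩ :=
    exists_split_cm_nonCM_curves hE1 hniso hj₁ hj₂
  have hA : IsSmoothProjective (T.prod (⨁ EC)).dim (T.prod (⨁ EC)).X := AbelianVariety.isSmoothProjective_holds
  haveI := BettiUniverse.finite hA 1
  have hXQ : IsIsogenous X ((T.prod (⨁ EC)).prod (⨁ EN)) :=
    (hXP.trans ((IsIsogenous.refl T).prod hsplit)).trans (Literature.AlgebraicGeometry.HodgeTheory.isIsogenous_prod_assoc T (⨁ EC) (⨁ EN)).symm'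
  have hAE : ∀ j, ∀ u : T.prod (⨁ EC) ⟶ EN j, u = 0 := fun j =>
    hom_prod_eq_zero_of_forall_eq_zero (hTE0 (hEN1 j)) fun v => biproduct.hom_ext' _ _ fun i => by
      rw [comp_zero]
      exact hom_eq_zero_of_isSimple_of_not_isIsogenous (isSimple_of_dim_le_one (hEC1 i).le) (isSimple_of_dim_le_one (hEN1 j).le) (hCN i j) _
  have hN := mtRank_hodge_one_eq_add_of_isIsogenous_prod_biproduct_nonCM_curves hX hA (by rw [dim_prod]; omega) hEN1 hENcm hENniso hAE hXQ
  have hforC : ∀ i, IsEmpty ((EC i).endAlgebra →+* T.endAlgebra) := fun i => by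
    obtain ⟨j, hj⟩ := hCE i; rw [hj]; exact hfor j (hj ▸ hECcm i)
  have hC := mtRank_hodge_one_eq_of_isIsogenous_typeIV_threefold_prod_biproduct_cmCurves hA hTs hT3 hTE hEC1 hECcm hECniso hforC
    (IsIsogenous.refl _)
  have h' := mtRank_hodge_one_eq_of_biproduct_cm_curves_prod_biproduct_nonCM_curves hX' hEC1 hECcm hECniso hEN1 hENcm hENniso
    (hX'E.trans hsplit)
  omega

/-- **`t(T × ⨁E) + 2 = t(T) + t(⨁E)`** for a simple abelian threefold `T` with `dim_ℚ End⁰T = 2`, pairwise non-isogenous elliptic curves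
`E₀, …, E_m` (CM or not), and SOME CM curve `E_{j₀}` with `End⁰E_{j₀} ↪ End⁰T`: its torus `U(1)` is absorbed in `Hg(T) = U(2,1)` (§1), every
other curve contributes as in the free case. [cite: MoonenZarhin1999LowDim, Thm. 0.1 (4), §3 (3.4), (3.6) and (3.8)]
[cite: Gordon1999HodgeAVSurvey, §3 Theorem (Imai) and 7.6.1] -/
theorem mtRank_hodge_one_add_two_eq_of_isIsogenous_typeIV_threefold_prod_biproduct_curves_of_nonempty (hX : IsSmoothProjective n X.X)
    (hX' : IsSmoothProjective n' X'.X) (hTs : T.IsSimple) (hT3 : T.dim = 3) (hTE : Module.finrank ℚ T.endAlgebra = 2)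
    (hE1 : ∀ j, (E j).dim = 1) (hniso : ∀ i j, i ≠ j → ¬ IsIsogenous (E i) (E j))
    {j₀ : Fin (m + 1)} (hj₀cm : IsOfCMType (E j₀)) (hj₀ : Nonempty ((E j₀).endAlgebra →+* T.endAlgebra))
    (hXP : IsIsogenous X (T.prod (⨁ E))) (hX'E : IsIsogenous X' (⨁ E)) :
    haveI := BettiUniverse.finite hX 1
    haveI := BettiUniverse.finite hX' 1
    (BettiUniverse.hodge exists_isReal_hodgeModel_holds hX 1).mtRank + 2 =
      10 + (BettiUniverse.hodge exists_isReal_hodgeModel_holds hX' 1).mtRank := by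
  classical
  haveI := BettiUniverse.finite hX 1
  haveI := BettiUniverse.finite hX' 1
  have hT : IsSmoothProjective T.dim T.X := AbelianVariety.isSmoothProjective_holds
  haveI := BettiUniverse.finite hT 1
  have hTE0 : ∀ {C : AbelianVariety ℂ}, C.dim = 1 → ∀ u : T ⟶ C, u = 0 := fun hC1 u =>
    hom_eq_zero_of_isSimple_of_not_isIsogenous hTs (isSimple_of_dim_le_one hC1.le)
      (fun h => by have hd : T.dim = _ := dim_eq_of_isIsogenous_holds h; rw [hC1] at hd; omega) u
  by_cases hall : ∀ j, IsOfCMType (E j)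
  · -- all CM: §1 `m + 10` against Kubota `m + 2`
    have h := mtRank_hodge_one_eq_of_isIsogenous_typeIV_threefold_prod_biproduct_cmCurves_of_nonempty hX hTs hT3 hTE hE1 hall hniso hj₀ hXP
    have h' := mtRank_hodge_one_eq_card_add_one_of_isIsogenous_biproduct_elliptic (C := Fin (m + 1)) hE1 hall hniso (cls := id)
      Function.surjective_id hX' hX'E
    rw [Fintype.card_fin] at h'
    omega
  -- mixed (the family contains the CM curve `E_{j₀}`): split by «CM»
  push Not at hall
  obtain ⟨j₁, hj₁⟩ := hall
  obtain ⟨mC, mN, EC, EN, hcard, hCE, hNE, hCsurj, hEC1, hEN1, hECcm, hENcm, hECniso, hENniso, hCN, hsplit⟩ :=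
    exists_split_cm_nonCM_curves hE1 hniso hj₁ hj₀cm
  have hA : IsSmoothProjective (T.prod (⨁ EC)).dim (T.prod (⨁ EC)).X := AbelianVariety.isSmoothProjective_holds
  haveI := BettiUniverse.finite hA 1
  have hXQ : IsIsogenous X ((T.prod (⨁ EC)).prod (⨁ EN)) :=
    (hXP.trans ((IsIsogenous.refl T).prod hsplit)).trans (Literature.AlgebraicGeometry.HodgeTheory.isIsogenous_prod_assoc T (⨁ EC) (⨁ EN)).symm'
  have hAE : ∀ j, ∀ u : T.prod (⨁ EC) ⟶ EN j, u = 0 := fun j =>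
    hom_prod_eq_zero_of_forall_eq_zero (hTE0 (hEN1 j)) fun v => biproduct.hom_ext' _ _ fun i => by
      rw [comp_zero]
      exact hom_eq_zero_of_isSimple_of_not_isIsogenous (isSimple_of_dim_le_one (hEC1 i).le) (isSimple_of_dim_le_one (hEN1 j).le) (hCN i j) _
  have hN := mtRank_hodge_one_eq_add_of_isIsogenous_prod_biproduct_nonCM_curves hX hA (by rw [dim_prod]; omega) hEN1 hENcm hENniso hAE hXQ
  -- the CM part contains `E_{j₀}`
  obtain ⟨i₀, hi₀⟩ := hCsurj j₀ hj₀cm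
  have hi₀' : Nonempty ((EC i₀).endAlgebra →+* T.endAlgebra) := by rw [hi₀]; exact hj₀
  have hC := mtRank_hodge_one_eq_of_isIsogenous_typeIV_threefold_prod_biproduct_cmCurves_of_nonempty hA hTs hT3 hTE hEC1 hECcm hECniso hi₀'
    (IsIsogenous.refl _)
  have h' := mtRank_hodge_one_eq_of_biproduct_cm_curves_prod_biproduct_nonCM_curves hX' hEC1 hECcm hECniso hEN1 hENcm hENniso
    (hX'E.trans hsplit)
  omega

/-! ## §3 The cells `t(T × E₀ × ⋯ × E_m) = 3a + b + 10 − δ` -/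

/-- **`t(T × E₀ × ⋯ × E_m) = 3a + b + 10`** (`a` non-CM curves, `b` CM curves, pairwise non-isogenous, no CM field inside `End⁰T`), in the tree's
packaging of `a`, `b` (`t(⨁E) = 3a + b + 1`, `CorCM/MumfordTateRankProductsOfCurves`). [cite: MoonenZarhin1999LowDim, §3 (3.4), (3.6) and (3.8)] -/
theorem exists_mtRank_hodge_one_eq_of_isIsogenous_typeIV_threefold_prod_biproduct_curves_of_isEmpty (hX : IsSmoothProjective n X.X)
    (hTs : T.IsSimple) (hT3 : T.dim = 3) (hTE : Module.finrank ℚ T.endAlgebra = 2)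
    (hE1 : ∀ j, (E j).dim = 1) (hniso : ∀ i j, i ≠ j → ¬ IsIsogenous (E i) (E j))
    (hfor : ∀ j, IsOfCMType (E j) → IsEmpty ((E j).endAlgebra →+* T.endAlgebra)) (hXP : IsIsogenous X (T.prod (⨁ E))) :
    haveI := BettiUniverse.finite hX 1
    ∃ a b : ℕ, 1 ≤ a + b ∧ a + b ≤ m + 1 ∧ (BettiUniverse.hodge exists_isReal_hodgeModel_holds hX 1).mtRank = 3 * a + b + 10 ∧
      (a = 0 ↔ ∀ j, IsOfCMType (E j)) ∧ (b = 0 ↔ ∀ j, ¬ IsOfCMType (E j)) := by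
  haveI := BettiUniverse.finite hX 1
  have hY : IsSmoothProjective (⨁ E).dim (⨁ E).X := AbelianVariety.isSmoothProjective_holds
  haveI := BettiUniverse.finite hY 1
  have h := mtRank_hodge_one_add_one_eq_of_isIsogenous_typeIV_threefold_prod_biproduct_curves_of_isEmpty hX hY hTs hT3 hTE hE1 hniso hfor hXP
    (IsIsogenous.refl _)
  obtain ⟨a, b, h1, hm, ht, ha, hb⟩ := exists_mtRank_hodge_one_eq_of_biproduct_curves hY hE1 (IsIsogenous.refl _)
  exact ⟨a, b, h1, hm, by omega, ha, hb⟩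

/-- **`t(T × E₀ × ⋯ × E_m) = 3a + b + 9`** (`a` non-CM curves, `b ≥ 1` CM curves, pairwise non-isogenous, SOME CM field inside `End⁰T`).
[cite: MoonenZarhin1999LowDim, Thm. 0.1 (4), §3 (3.4), (3.6) and (3.8)] -/
theorem exists_mtRank_hodge_one_eq_of_isIsogenous_typeIV_threefold_prod_biproduct_curves_of_nonempty (hX : IsSmoothProjective n X.X)
    (hTs : T.IsSimple) (hT3 : T.dim = 3) (hTE : Module.finrank ℚ T.endAlgebra = 2)
    (hE1 : ∀ j, (E j).dim = 1) (hniso : ∀ i j, i ≠ j → ¬ IsIsogenous (E i) (E j))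
    {j₀ : Fin (m + 1)} (hj₀cm : IsOfCMType (E j₀)) (hj₀ : Nonempty ((E j₀).endAlgebra →+* T.endAlgebra)) (hXP : IsIsogenous X (T.prod (⨁ E))) :
    haveI := BettiUniverse.finite hX 1
    ∃ a b : ℕ, 1 ≤ b ∧ a + b ≤ m + 1 ∧ (BettiUniverse.hodge exists_isReal_hodgeModel_holds hX 1).mtRank = 3 * a + b + 9 ∧
      (a = 0 ↔ ∀ j, IsOfCMType (E j)) := by
  haveI := BettiUniverse.finite hX 1
  have hY : IsSmoothProjective (⨁ E).dim (⨁ E).X := AbelianVariety.isSmoothProjective_holds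
  haveI := BettiUniverse.finite hY 1
  have h := mtRank_hodge_one_add_two_eq_of_isIsogenous_typeIV_threefold_prod_biproduct_curves_of_nonempty hX hY hTs hT3 hTE hE1 hniso hj₀cm hj₀
    hXP (IsIsogenous.refl _)
  obtain ⟨a, b, h1, hm, ht, ha, hb⟩ := exists_mtRank_hodge_one_eq_of_biproduct_curves hY hE1 (IsIsogenous.refl _)
  have hb1 : 1 ≤ b := by
    rcases Nat.eq_zero_or_pos b with hb0 | hb0
    · exact absurd hj₀cm (hb.1 hb0 j₀)
    · exact hb0
  exact ⟨a, b, hb1, hm, by omega, ha⟩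

end Summit.HodgeConjecture.CorCM

end
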